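import Summits.NavierStokesRegularity.NavierStokesRegularity.Theses.EulerMelnikovDss

/-!
# Birth skeleton — piece `PeriodicEulerSeed` (stmt-NavierStokesRegularity-1415) of the BC2
  decomposition of `FastBranchProfiles` (stmt-NavierStokesRegularity-1414), route EulerMelnikovDss

Three registered stubs and the kernel-checked composition `PeriodicEulerSeed_of`, concluding the
route decl `Theses.EulerMelnikovDss.PeriodicEulerSeed` by name.

IDEA (symmetric seeds satisfy every selection rule for free). The admissibility clauses of the seed —
zero impulse `∫ y × ω = 0`, zero angular impulse `∫ |y|² ω = 0`, zero mean helicity dissipation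
`∫₀ᴾ ∫ ⟨ω, curl ω⟩ = 0`, and "no axis of rotational symmetry" — all follow from EQUIVARIANCE UNDER THE
FULL (HYPER)OCTAHEDRAL GROUP `O_h ⊂ O(3)` (signed permutations of the axes): the rotation subgroup
`O` fixes no nonzero (pseudo)vector, so the vector-valued invariants `∫ y × ω`, `∫ |y|² ω` vanish;
`O_h` contains `−id`, under which `⟨ω, curl ω⟩` is ODD (ω is a pseudovector), so the helicity
dissipation vanishes slice by slice; and an `O_h`-equivariant smooth solenoidal `L²` field that is
also axisymmetric about some (possibly affine, possibly conjugated) axis is invariant under rotations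
about ≥ 3 concurrent axes or under a translation, hence zero — contradicting genuine time dependence.
So the open existence problem is reduced to its symmetric core: a genuinely time-dependent,
time-periodic (modulo an isometry), finite-energy smooth Euler flow on `ℝ³` with rapidly decaying
vorticity and `O_h` symmetry (candidates: octahedral vorton / ring configurations continued by the
degenerate KAM–Nash–Moser scheme of GarciaHassainiaHmidi2026; none known).

* `stub_octahedralPeriodicEuler` (XL, the open core): existence of such an `O_h`-equivariant seed.
* `stub_selectionRules_of_octahedral` (M): `O_h`-equivariance ⇒ `∫ y × ω = 0`, `∫ |y|² ω = 0`,
  `∫ ⟨ω, curl ω⟩ = 0` on every slice (change of variables under the isometries; pseudovector sign).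
* `stub_noAxis_of_octahedral` (M): `O_h`-equivariance + solenoidal + `L²` + genuine time dependence ⇒
  no axis of axisymmetry in any conjugated, translated frame.
* `PeriodicEulerSeed_of` — real proof (assembly of the clauses; the period integral of the
  slice-wise vanishing helicity dissipation is `0`).
-/

namespace Summit.NavierStokesRegularity.NavierStokesRegularity.Cruxes.FastBranchProfiles.BirthSeed

open scoped Topology
open Filter Set Function MeasureTheory
open Summit.NavierStokesRegularity.NavierStokesRegularity.Theses.EulerMelnikovDss
open Literature.Analysis.FluidPDE

set_option linter.dupNamespace false

/-- STUB A (the open core): an `O_h`-equivariant, genuinely time-dependent, time-periodic (modulo an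
isometry) finite-energy smooth Euler flow on `ℝ³` with rapidly decaying vorticity. -/
theorem stub_octahedralPeriodicEuler : ∃ (W : ℝ → EuclideanSpace ℝ (Fin 3) → EuclideanSpace ℝ (Fin 3)) (q : ℝ → EuclideanSpace ℝ (Fin 3) → ℝ) (P : ℝ) (Q : EuclideanSpace ℝ (Fin 3) ≃ₗᵢ[ℝ] EuclideanSpace ℝ (Fin 3)), 0 < P ∧ Literature.Analysis.FluidPDE.IsClassicalEulerSolutionOn Set.univ 0 W q ∧ (∀ σ y, W (σ + P) (Q y) = Q (W σ y)) ∧ (∃ σ y, W σ y ≠ W 0 y) ∧ (∀ σ, MemLp (W σ) 2 volume) ∧ (∀ k : ℕ, ∃ A : ℝ, ∀ σ y, ‖y‖ ^ k * ‖Literature.Analysis.FluidPDE.curl (W σ) y‖ ≤ A) ∧ (∀ S : EuclideanSpace ℝ (Fin 3) ≃ₗᵢ[ℝ] EuclideanSpace ℝ (Fin 3), (∀ i : Fin 3, ∃ j : Fin 3, S (EuclideanSpace.single i (1:ℝ)) = EuclideanSpace.single j 1 ∨ S (EuclideanSpace.single i (1:ℝ)) = -EuclideanSpace.single j 1) → ∀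 σ y, W σ (S y) = S (W σ y)) := by
  sorry

/-- STUB B (symmetry calculus): `O_h`-equivariance forces zero impulse, zero angular impulse and
zero helicity dissipation on every slice. -/
theorem stub_selectionRules_of_octahedral : ∀ (W : ℝ → EuclideanSpace ℝ (Fin 3) → EuclideanSpace ℝ (Fin 3)) (q : ℝ → EuclideanSpace ℝ (Fin 3) → ℝ) (P : ℝ) (Q : EuclideanSpace ℝ (Fin 3) ≃ₗᵢ[ℝ] EuclideanSpace ℝ (Fin 3)), Literature.Analysis.FluidPDE.IsClassicalEulerSolutionOn Set.univ 0 W q → (∀ σ, MemLp (W σ) 2 volume) → (∀ k : ℕ, ∃ A : ℝ, ∀ σ y, ‖y‖ ^ k * ‖Literature.Analysis.FluidPDE.curl (W σ) y‖ ≤ A) → (∀ S : EuclideanSpace ℝ (Fin 3) ≃ₗᵢ[ℝ] EuclideanSpace ℝ (Fin 3), (∀ i : Fin 3, ∃ j : Fin 3, S (EuclideanSpace.single i (1:ℝ)) = EuclideanSpace.single j 1 ∨ S (EuclideanSpace.single i (1:ℝ)) = -EuclideanSpace.single j 1) → ∀ σ y, W σ (S y) = S (W σ y)) → (∀ σ,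 ∫ y, Literature.Analysis.FluidPDE.cross y (Literature.Analysis.FluidPDE.curl (W σ) y) = 0) ∧ (∀ σ, ∫ y, (‖y‖ ^ 2) • Literature.Analysis.FluidPDE.curl (W σ) y = 0) ∧ (∀ σ, ∫ y, inner ℝ (Literature.Analysis.FluidPDE.curl (W σ) y) (Literature.Analysis.FluidPDE.curl (Literature.Analysis.FluidPDE.curl (W σ)) y) = 0) := by
  sorry

/-- STUB C (rigidity): an `O_h`-equivariant genuinely time-dependent seed has no axis of
axisymmetry in any conjugated / translated frame. -/
theorem stub_noAxis_of_octahedral : ∀ (W : ℝ → EuclideanSpace ℝ (Fin 3) → EuclideanSpace ℝ (Fin 3)) (q : ℝ → EuclideanSpace ℝ (Fin 3) → ℝ) (P : ℝ) (Q : EuclideanSpace ℝ (Fin 3) ≃ₗᵢ[ℝ] EuclideanSpace ℝ (Fin 3)), Literature.Analysis.FluidPDE.IsClassicalEulerSolutionOn Set.univ 0 W q → (∀ σ, MemLp (W σ) 2 volume) → (∀ S : EuclideanSpace ℝ (Fin 3) ≃ₗᵢ[ℝ] EuclideanSpace ℝ (Fin 3), (∀ i : Fin 3, ∃ j : Fin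 3, S (EuclideanSpace.single i (1:ℝ)) = EuclideanSpace.single j 1 ∨ S (EuclideanSpace.single i (1:ℝ)) = -EuclideanSpace.single j 1) → ∀ σ y, W σ (S y) = S (W σ y)) → (∃ σ y, W σ y ≠ W 0 y) → (∀ (R : EuclideanSpace ℝ (Fin 3) ≃ₗᵢ[ℝ] EuclideanSpace ℝ (Fin 3)) (a : EuclideanSpace ℝ (Fin 3)), ¬ ∀ σ, Literature.Analysis.FluidPDE.IsAxisymmetric (fun y => R.symm (W σ (R y + a)))) := by
  sorry

/-- COMPOSITION (kernel-checked, no sorry): the three stubs give the piece. -/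
theorem PeriodicEulerSeed_of
    (hA : ∃ (W : ℝ → EuclideanSpace ℝ (Fin 3) → EuclideanSpace ℝ (Fin 3)) (q : ℝ → EuclideanSpace ℝ (Fin 3) → ℝ) (P : ℝ) (Q : EuclideanSpace ℝ (Fin 3) ≃ₗᵢ[ℝ] EuclideanSpace ℝ (Fin 3)), 0 < P ∧ Literature.Analysis.FluidPDE.IsClassicalEulerSolutionOn Set.univ 0 W q ∧ (∀ σ y, W (σ + P) (Q y) = Q (W σ y)) ∧ (∃ σ y, W σ y ≠ W 0 y) ∧ (∀ σ, MemLp (W σ) 2 volume) ∧ (∀ k : ℕ, ∃ A : ℝ, ∀ σ y, ‖y‖ ^ k * ‖Literature.Analysis.FluidPDE.curl (W σ) y‖ ≤ A) ∧ (∀ S : EuclideanSpace ℝ (Fin 3) ≃ₗᵢ[ℝ] EuclideanSpace ℝ (Fin 3), (∀ i : Fin 3, ∃ j : Fin 3, S (EuclideanSpace.single i (1:ℝ)) = EuclideanSpace.single j 1 ∨ S (EuclideanSpace.single i (1:ℝ)) = -EuclideanSpace.single j 1) → ∀ σ y, W σ (S y) = S (W σ y)))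
    (hB : ∀ (W : ℝ → EuclideanSpace ℝ (Fin 3) → EuclideanSpace ℝ (Fin 3)) (q : ℝ → EuclideanSpace ℝ (Fin 3) → ℝ) (P : ℝ) (Q : EuclideanSpace ℝ (Fin 3) ≃ₗᵢ[ℝ] EuclideanSpace ℝ (Fin 3)), Literature.Analysis.FluidPDE.IsClassicalEulerSolutionOn Set.univ 0 W q → (∀ σ, MemLp (W σ) 2 volume) → (∀ k : ℕ, ∃ A : ℝ, ∀ σ y, ‖y‖ ^ k * ‖Literature.Analysis.FluidPDE.curl (W σ) y‖ ≤ A) → (∀ S : EuclideanSpace ℝ (Fin 3) ≃ₗᵢ[ℝ] EuclideanSpace ℝ (Fin 3), (∀ i : Fin 3, ∃ j : Fin 3, S (EuclideanSpace.single i (1:ℝ)) = EuclideanSpace.single j 1 ∨ S (EuclideanSpace.single i (1:ℝ)) = -EuclideanSpace.single j 1) → ∀ σ y, W σ (S y) = S (W σ y)) → (∀ σ, ∫ y, Literature.Analysis.FluidPDE.cross y (Literature.Analysis.FluidPDE.curl (W σ) y) = 0) ∧ (∀ σ, ∫ y, (‖y‖ ^ 2) • Literature.Analysis.FluidPDE.curl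 (W σ) y = 0) ∧ (∀ σ, ∫ y, inner ℝ (Literature.Analysis.FluidPDE.curl (W σ) y) (Literature.Analysis.FluidPDE.curl (Literature.Analysis.FluidPDE.curl (W σ)) y) = 0))
    (hC : ∀ (W : ℝ → EuclideanSpace ℝ (Fin 3) → EuclideanSpace ℝ (Fin 3)) (q : ℝ → EuclideanSpace ℝ (Fin 3) → ℝ) (P : ℝ) (Q : EuclideanSpace ℝ (Fin 3) ≃ₗᵢ[ℝ] EuclideanSpace ℝ (Fin 3)), Literature.Analysis.FluidPDE.IsClassicalEulerSolutionOn Set.univ 0 W q → (∀ σ, MemLp (W σ) 2 volume) → (∀ S : EuclideanSpace ℝ (Fin 3) ≃ₗᵢ[ℝ] EuclideanSpace ℝ (Fin 3), (∀ i : Fin 3, ∃ j : Fin 3, S (EuclideanSpace.single i (1:ℝ)) = EuclideanSpace.single j 1 ∨ S (EuclideanSpace.single i (1:ℝ)) = -EuclideanSpace.single j 1) → ∀ σ y, W σ (S y) = S (W σ y)) → (∃ σ y, W σ y ≠ W 0 y) → (∀ (R : EuclideanSpace ℝ (Fin 3) ≃ₗᵢ[ℝ] EuclideanSpace ℝ (Fin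 3)) (a : EuclideanSpace ℝ (Fin 3)), ¬ ∀ σ, Literature.Analysis.FluidPDE.IsAxisymmetric (fun y => R.symm (W σ (R y + a))))) :
    PeriodicEulerSeed := by
  obtain ⟨W, q, P, Q, hP, hE, hper, hnt, hL2, hdec, hsym⟩ := hA
  obtain ⟨hI, hAng, hHel⟩ := hB W q P Q hE hL2 hdec hsym
  have hax := hC W q P Q hE hL2 hsym hnt
  refine ⟨W, q, P, Q, hP, hE, hper, hnt, hL2, hdec, hI, hAng, ?_, hax⟩
  -- the period integral of the slice-wise vanishing helicity dissipation vanishes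
  simp [hHel]

end Summit.NavierStokesRegularity.NavierStokesRegularity.Cruxes.FastBranchProfiles.BirthSeed
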